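import Summits.BirchSwinnertonDyer.BirchSwinnertonDyer.Theorems.AdditiveBranchIMCMultLowerTameRoadsMultClosedKolyvagin
import Summits.BirchSwinnertonDyer.BirchSwinnertonDyer.Theses.AdditiveBranchIMC
import HarnessLib

/-!
# Line `tame-roads-mult` on crux `AdditiveBranchIMC.MultLower` (stmt-BirchSwinnertonDyer-19359) — skeleton v31

v31 (LEAD cruxlead-19357 g12, 2026-08-29): EVERY CITED NAME IS NOW A SINGLE PRIMARY THEOREM — STILL TWELVE (+ `hAFC`). The two CONSOLIDATED
statements left on v30's list are replaced, count-neutrally, by the one primary theorem each really adds: (i) «GZK»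
(`rank_eq_analyticRank_of_analyticRank_le_one`, Darmon 2004 Thm. 3.22) ↦ KOLYVAGIN 1990 Thm. A (`kolyvagin N W K`: the Heegner point of infinite
order ⇒ `rank E(K) = 1`, `Ш(E/K)` finite), its other inputs — the modular parametrisation, Hoffstein–Luo ⟹ Waldspurger, BFH 1990 (i) ⟹
Murty–Murty, Cai–Shu–Tian ring class ⟹ Gross–Zagier at every level — being on the list already (`Theorems/AdditiveBranchIMCGrossZagierKolyvaginOfKolyvagin.lean`,
LEAD g12); (ii) Nekovář 2007 (4.9) ↦ THE EICHLER–SHIMURA CONGRUENCE RELATION read pointwise on `E`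
(`ModularForms.eichlerShimuraRelation_heckeNeighbour`, Shimura 1971 Thm. 7.9; `Nekovar2007.cmPoint_frobeniusCongruence_of_eichlerShimuraRelation`).
`roadRowM_closed` is now ONE application of `TameRoadsMultClosedKolyvagin.missingLowerBoundAt_of_roadRowM_twelveFacts_kolyvagin`
(`Theorems/…TameRoadsMultClosedKolyvagin.lean`, LEAD g12). Registered stub NAMES AND SIGNATURES UNCHANGED (`stub_residualM`,
`stub_printedFactsM : PrintedFactsM`, `stub_tameAwayFromCycM`). READING: «19359 tame_roads_mult: road sub-row CLOSED MOD PRINT (12 single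
primary theorems: Delbourgo P4, Kolyvagin 1990 Thm A, modular parametrisation, Kato–Wuthrich half, BFH 1990 (i), Skinner 2016 Thm C, CST ring
class, Mazur, Hsieh B, LZZ, Hoffstein–Luo, Eichler–Shimura relation) + ONE research statement (stub_tameAwayFromCycM); open: stub_residualM
[research], stub_tameAwayFromCycM [research]».

v30 (LEAD cruxlead-19357 g11, 2026-08-29): THE CITE STUB SHRINKS TO TWELVE. Both ramified Friedberg–Hoffstein twists leave `PrintedFactsM`:
F5 (`friedbergHoffstein_exists_twist_ne_zero_ramifiedAt_splitAt`, the central-value twist of the rank-`1` rows) is now a THEOREM from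
Hoffstein–Luo 1997 (conjunct already listed) and the modular parametrisation, and F6 (`…simpleZero_ramifiedAt_splitAt`, the rank-`0` rows) a
THEOREM from Bump–Friedberg–Hoffstein 1990 Theorem (i) (`bumpFriedbergHoffstein_exists_heegnerField_split_twist_simpleZero`, typed `ε = +1`
instance, NEW on the list) and the modular parametrisation — both through LEAD g11's tree engine for the root number of a quadratic twist
RAMIFIED at the non-split multiplicative Wan prime (`w(E^{(qℓ)}) = w(E)`: Literature `RootNumberQuadraticTwistSharedPrimeProofs` p743700,
`RootNumberTwistAtkinLehnerChiFourProofs` p744317, `NonvanishingTwistsPrescribedRamificationOfHoffsteinLuoProofs` p744184; Theorems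
`AdditiveBranchIMCTwistRootNumberOdd` p744621 for EVERY odd `q`, `…RamifiedTwists` p744779). Net: THIRTEEN → TWELVE names (−F5 −F6 +BFH).
`roadRowM_closed` is now ONE application of `TameRoadsMultClosedBFH.missingLowerBoundAt_of_roadRowM_twelveFacts_bfh`
(`Theorems/…TameRoadsMultClosedBFH.lean`, LEAD g11). Registered stub NAMES AND SIGNATURES UNCHANGED. READING: «19359 tame_roads_mult: road
sub-row CLOSED MOD PRINT (12 names) + ONE research statement (stub_tameAwayFromCycM); open: stub_residualM [research], stub_tameAwayFromCycM [research]».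

v29 (LEAD cruxlead-19357 g10, 2026-08-29): THE CITE STUB SHRINKS TO THIRTEEN. Two of v28's fifteen cite conjuncts are now THEOREMS OF THE TREE
modulo conjuncts the stub keeps: Cai–Shu–Tian 2014 Thm. 1.1 for the TRIVIAL character (`CaiShuTian2014.thm11_trivialChar`, general Heegner
condition with the factor `2^{−μ(N,D)}`) is DISCHARGED from the ring-class statement `CaiShuTian2014.thm11_ringClassChar` modulo the modular
parametrisation (`ExplicitGrossZagierTrivialChar.thm11_trivialChar_of_thm11_ringClassChar`, `Theorems/AdditiveBranchIMCExplicitGrossZagierTrivialCharOfRingClass.lean`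
p739011, LEAD g10; Shimura reciprocity at conductor `1` WITHOUT `gcd(N, d_K) = 1`, Literature `HeegnerPointsOfConductorOneGaloisConjBirchProofs`
p738740), and Gross–Zagier 1986 Thm. I.(7.3) over `ℚ` (`GrossZagier1986_thm_I_7_3`) is DISCHARGED from the modular parametrisation, Hoffstein–Luo
1997 and the ring-class statement (`ExplicitGrossZagierTrivialChar.GrossZagier1986_thm_I_7_3_of_thm11_ringClassChar`,
`Theorems/AdditiveBranchIMCGrossZagierRationalPointOfRingClass.lean`, LEAD g10). `roadRowM_closed` is now ONE application of
`TameRoadsMultClosedThirteen.missingLowerBoundAt_of_roadRowM_thirteenFacts` (`Theorems/…TameRoadsMultClosedThirteen.lean`, LEAD g10).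
Registered stub NAMES AND SIGNATURES UNCHANGED. READING: «19359 tame_roads_mult: road sub-row CLOSED MOD PRINT (13 names) + ONE research
statement (stub_tameAwayFromCycM); open: stub_residualM [research], stub_tameAwayFromCycM [research]».

v28 (LEAD cruxlead-19357 g9, 2026-08-29): THE CITE STUB SHRINKS TO FIFTEEN. Gross 1991 Prop. 5.3 under Birch's condition, pinned
(`GrossLMS1991.prop53_conj_pinned_birch`) is DISCHARGED (conductor level outright; every level modulo the listed modular parametrisation:
`GrossLMS1991.prop53_conj_pinned_birch_of_exists_isNewformOf`, Literature `HeegnerPointsOfConductorConjugationBirchProofs` +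
`HeegnerPointsOfConductorGaloisOrbitBirchProofs` p733283, LEAD g9). `roadRowM_closed` is now ONE application of
`TameRoadsMultClosedFifteen.missingLowerBoundAt_of_roadRowM_fifteenFacts` (`Theorems/…TameRoadsMultClosedFifteen.lean`, LEAD g9). Registered stub
NAMES AND SIGNATURES UNCHANGED. READING: «19359 tame_roads_mult: road sub-row CLOSED MOD PRINT (15 names) + ONE research statement
(stub_tameAwayFromCycM); open: stub_residualM [research], stub_tameAwayFromCycM [research]».

v27 (LEAD cruxlead-19357 g9, 2026-08-29): THE CITE STUB SHRINKS TO SIXTEEN. Three of v26's nineteen cite conjuncts are now THEOREMS OF THE TREE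
and leave `PrintedFactsM`: the entire continuation and the parity fact (derived from the modular parametrisation inside p727769
`TameRoadsMultClosedSeventeen.…_seventeenFacts`, LEAD g8) and the Birch-keyed CM rationality of the Heegner points of conductor `n`
(`phi_heegnerPointOfConductor_mem_range_map_ringClassField_birch`, DISCHARGED by `forall_phi_heegnerPointOfConductor_mem_range_map_ringClassField_birch`,
Literature `HeegnerPointsOfConductorRationalityBirchProofs` p730874, LEAD g9). `roadRowM_closed` is now ONE application of
`TameRoadsMultClosedSixteen.missingLowerBoundAt_of_roadRowM_sixteenFacts` (`Theorems/AdditiveBranchIMCMultLowerTameRoadsMultClosedSixteen.lean`,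
LEAD g9). Registered stub NAMES AND SIGNATURES UNCHANGED (`stub_residualM`, `stub_printedFactsM : PrintedFactsM`, `stub_tameAwayFromCycM`).
READING: «19359 tame_roads_mult: road sub-row CLOSED MOD PRINT (16 names) + ONE research statement (stub_tameAwayFromCycM); open:
stub_residualM [research], stub_tameAwayFromCycM [research]».

v26 (LEAD cruxlead-19357 g8, 2026-08-29): THE COMPOSITION IS A THEOREMS-SIDE KERNEL OBJECT. The whole glue of v25 (every road stub except the
research residual a theorem; twenty theorems wiring ~40 helper files) now lives, sorry-free and gate-audited, in
`Theorems/AdditiveBranchIMCMultLowerTameRoadsMultClosed.lean` (p725639: `TameRoadsMultClosed.jointLowerBoundAt_tameRoadRowM` — field 1 from the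
two-variable divisibility at `(E, p, K)`; `jointUpperBoundAt_genusM` — field 2, genus Gross–Zagier + Kolyvagin over `K″` + the splitting of `Ш`;
`missingLowerBoundAt_of_roadRowM` — THE (M) ROAD SUB-ROW in analytic rank `≤ 1` from NINETEEN printed theorems and ONE research statement), with
the printed facts AND the research statement as NAMED HYPOTHESES. This skeleton is therefore reduced to its honest content in the shape of
record (director-bsd g18 (390), VARIANT-N; (368)(1) for the research residual): ONE cite stub `stub_printedFactsM` [CITE-ONLY — never a proof
target, never benched] whose conjuncts are the NINETEEN printed theorems the composition consumes (v25 listed twenty-three: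
`bsdRHS_eq_of_isIsogenous` and `Hsieh2014.thmA_…` were idle and are dropped; `Gross2004.rankinLSeries_eq_mul_quadraticTwist` and
`Voight2007.prop38_sqrt_mem_ringClassField_iff` are DISCHARGED by their tree proofs inside p725639), ONE research stub `stub_residualM` [by design:
the rows OUTSIDE the road sub-row], ONE research stub `stub_tameAwayFromCycM` [the named RESEARCH RESIDUAL: the two-variable divisibility
away from the cyclotomic variable with its anticyclotomic restriction for the MULTIPLICATIVE partner `V` (`π_{V,p}` Steinberg, branch character
`χ_{p*}∘N`) — no refereed source; Castella–Liu–Wan 2022 Thm. 8.2.1 needs `π_p` unramified], the in-file closed theorem `roadRowM_closed :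
PrintedFactsM → (∀ …, TameAwayFromCycAt …) → (road sub-row ⟹ MissingLowerBoundAt)` [CLOSED MOD PRINT + hAFC], and the composition
`MultLower_of`. Registered stub NAMES AND SIGNATURES UNCHANGED. Vocabulary (`WanPrime`, `TameRoadRow`, `TameRoadField`,
`RamifiedKolyvaginFieldM`) = the Theorems-side copies in `ThreeFieldRoadSupply` (verbatim v3's); `RoadRowM` and `TameAwayFromCycAt` stay here
(they appear in the registered signatures). READING: «19359 tame_roads_mult: road sub-row CLOSED MOD PRINT (19 names) + ONE research
statement (stub_tameAwayFromCycM); open: stub_residualM [research], stub_tameAwayFromCycM [research]».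

HISTORY v1–v25 (full texts: evidence `ev-skeleton-v25-tame_roads_mult.lean` on the item; `pub/bsd-addord/planner/cruxlead-19357-g7/`;
LeadReport1–16 in this directory): the (M) twin of `three_field_road` (crux 19357) — the same three fields with the (M) changes (partner `A`
NON-split multiplicative at `p` and at the Wan prime; field 3 = Skinner 2016 Thm C; rank `1` via the tree theorem
`AdditivePotMult.ClassX4M.missingUpperBoundAt_rankZero_of_surj_noL20`); supply w2 (`ThreeFieldRoadSupply.stub_fieldSupplyM`), partner w3
(p656543), genus (w4 + `road_fourthCurve_mult_min`), Kolyvagin leaves (LEAD g2–g4), tame road (LEAD g5–g7: local vanishing on cell (M)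
`TameLocalVanishing.tameLocalVanishing_cellM` p708909, exact control, specialisation, `T₁`-cancellation; the two-variable divisibility itself
is the research residual since v22). BSD is proved for no curve by any of this.
-/

set_option autoImplicit false
set_option linter.dupNamespace false

namespace Summit.BirchSwinnertonDyer.BirchSwinnertonDyer.Cruxes.MultLower.TameRoadsMult

open scoped Classical

open NumberField IsDedekindDomain
open WeierstrassCurve Literature.NumberTheory.EllipticCurves
  Literature.NumberTheory.EllipticCurves.ModularForms
  Literature.NumberTheory.EllipticCurves.Rank1Residual
  Literature.NumberTheory.EllipticCurves.Rank1Residual.Typed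

open Summit.BirchSwinnertonDyer.Rank1Residual
open Summit.BirchSwinnertonDyer.Rank1Residual.Additive
open Summit.BirchSwinnertonDyer.BirchSwinnertonDyer.Theses.AdditiveBranchIMC
open Summit.BirchSwinnertonDyer.BirchSwinnertonDyer.Theorems
open Field Literature.NumberTheory.EllipticCurves.ModularForms
open ThreeFieldRoadSupply (WanPrime TameRoadRow TameRoadField RamifiedKolyvaginFieldM)

/-! ### Vocabulary kept in the skeleton (it appears in the registered signatures) -/

/-- THE SUB-ROW OF THIS LINE: the tame sub-row, and in analytic rank `0` additionally `p ∤ ∏_ℓ c_ℓ(E)`.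
[predicate; nothing asserted] -/
def RoadRowM (W : WeierstrassCurve ℚ) [W.IsElliptic] [W.IsGloballyMinimal] (p : ℕ) [Fact p.Prime] : Prop :=
  TameRoadRow W p ∧ (W.analyticRank = 1 ∨ ¬ p ∣ W.tamagawaProduct)

/-- THE TWO-VARIABLE DIVISIBILITY AWAY FROM THE CYCLOTOMIC VARIABLE, WITH ITS ANTICYCLOTOMIC RESTRICTION, at `(E, p, K)` (v22; EXISTING
vocabulary only; verbatim v25): for every parametrisation `Dt` of level `N_E`, anticyclotomic `(κ, γ)`, degree-one `𝔭 ∣ p`, `𝔭′ ≠ 𝔭` over `p`,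
embedding datum `ι′` inducing `𝔭`, `X_ac^∅(E_K)_{𝔭′}` `Λ`-torsion and every completing pair `(κ₁, γ₁)`: a two-variable fraction `A/B` with
`B(0,·) ≠ 0`, a non-zero `h` in the cyclotomic variable alone, a ♭-frame `(Ω_K′, Ω_p′, Q′)` and the restriction `D` with
`h·B·ch_{Λ₂}(X_Gr₂(E_K)_{𝔭′})·Λ^ur ⊆ (A)`, `A(0,·) = B(0,·)·D`, `D ≠ 0`, `(D) ⊆ (Q′)`. In print on cell (G-ord) (Castella–Liu–Wan 2022 Thm. 8.2.1,
`π_p` unramified); on cell (M) (`π_{V,p}` Steinberg) RESEARCH-SHAPED. [predicate; nothing asserted]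
[cite: CastellaLiuWan2022, Thm. 8.2.1 (1) and §4.1 (arXiv:2109.08375)] [cite: JetchevSkinnerWan2017, §5.3 and Thm. 6.1.4 (arXiv:1512.06894 pp. 23–26)] -/
def TameAwayFromCycAt (W : WeierstrassCurve ℚ) [W.IsElliptic] [W.IsGloballyMinimal] (p : ℕ) [Fact p.Prime]
    (K : Type) [Field K] [NumberField K] : Prop :=
  ∀ (N : ℕ) [NeZero N] (Dt : ModularParametrizationData W N), W.conductorNorm ℤ = N →
    ∀ (κ : ZpExtension K p), κ.IsAnticyclotomic → ∀ (γ : Field.absoluteGaloisGroup K) [Fact (κ.IsTopGenerator γ)]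
      (𝔭 : HeightOneSpectrum (𝓞 K)), ((p : ℕ) : 𝓞 K) ∈ 𝔭.asIdeal → 𝔭.asIdeal.ramificationIdx (𝓞 ℚ) = 1 →
      𝔭.asIdeal.inertiaDeg (𝓞 ℚ) = 1 → ∀ (𝔭' : HeightOneSpectrum (𝓞 K)), ((p : ℕ) : 𝓞 K) ∈ 𝔭'.asIdeal → 𝔭' ≠ 𝔭 →
      ∀ (ι' : PadicAlgCl p ≃+* ℂ), SchneiderFree.BranchInducesPrime p ι' 𝔭 →
        Module.IsTorsion (IwasawaAlgebra p) (X11b.AcSelmer.XAc (W.baseChange K) p κ 𝔭' ∅ γ) →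
        ∀ (κ₁ : ZpExtension K p) (γ₁ : Field.absoluteGaloisGroup K) [Fact (ZpExtension.IsTopGeneratorPair κ₁ κ γ₁ γ)],
          ∃ (A B : PowerSeries (PowerSeries (PadicComplexInt p))) (h : PowerSeries (PadicComplexInt p))
            (ΩK' : ℂ) (Ωp' : ℂ_[p]) (Q' D : PowerSeries (PadicComplexInt p)),
            h ≠ 0 ∧ ΩK' ≠ 0 ∧ Ωp' ≠ 0 ∧ X11b.R1.IsBDPLFunctionInt p ι' 𝔭 κ γ Dt.f ΩK' Ωp' Q' ∧
            (∀ y ∈ (WeierstrassCurve.XGr₂.charIdeal (W.baseChange K) p κ₁ κ 𝔭' γ₁ γ).map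
                (IwasawaAlgebra₂.toUnr₂ p (X11b.R1.toCpInt p)),
              PowerSeries.map (PowerSeries.C : PadicComplexInt p →+* PowerSeries (PadicComplexInt p)) h * B * y ∈
                Ideal.span {A}) ∧
            PowerSeries.constantCoeff B ≠ 0 ∧ PowerSeries.constantCoeff A = PowerSeries.constantCoeff B * D ∧
            D ≠ 0 ∧ Ideal.span {D} ≤ Ideal.span {Q'}

/-! ### The cite stub's conjunction (v31: the twelve load-bearing printed theorems, each a single primary statement) -/

/-- THE PRINTED THEOREMS THE ROAD CONSUMES, BY NAME (cite-only conjunction; NOTHING is asserted — each conjunct is an existing Literature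
`Prop`, cited where it is declared). v31 = exactly the twelve printed hypotheses of
`TameRoadsMultClosedKolyvagin.missingLowerBoundAt_of_roadRowM_twelveFacts_kolyvagin`, in its order: Delbourgo 1998 Prop. 4; Kolyvagin 1990
Thm. A (`kolyvagin N W K`, at every level and field); a modular parametrisation; Kato/Wuthrich's cyclotomic half at a surjective prime;
Bump–Friedberg–Hoffstein 1990 Theorem (i) (typed `ε = +1` instance); Skinner 2016 Thm C; Cai–Shu–Tian Thm 1.1 (ring class character);
Mazur 1978 Cor. 4.1; Hsieh 2014 Thm B; Liu–Zhang–Zhang 2018; Hoffstein–Luo 1997; the Eichler–Shimura congruence relation (Shimura 1971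
Thm. 7.9, read pointwise on `E`). (v26's entire continuation, parity fact and Birch-keyed CM rationality, v27's Gross 1991 Prop. 5.3
pinned-Birch, v28's Cai–Shu–Tian Thm 1.1 for the trivial character and Gross–Zagier I.(7.3) over `ℚ`, v29's ramified Friedberg–Hoffstein
twists F5 / F6, and v30's «GZK» and Nekovář 2007 (4.9) are theorems of the tree modulo the listed names and are no longer listed.) -/
def PrintedFactsM : Prop :=
  Delbourgo1998.prop4_rankZero_pow_dvd_constantCoeff ∧
    (∀ (N : ℕ) [NeZero N] (W : WeierstrassCurve ℚ) (K : Type) [Field K] [NumberField K],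
      Literature.NumberTheory.EllipticCurves.kolyvagin N W K) ∧
    Literature.NumberTheory.EllipticCurves.ModularForms.nonempty_modularParametrizationData ∧
    Wuthrich2014.kato_halfEigenCharIdeal_dvd_cyclotomicPrime_of_surjective ∧
    bumpFriedbergHoffstein_exists_heegnerField_split_twist_simpleZero ∧
    Skinner2016.thmC_padicValRat_bsd_rank_zero ∧
    CaiShuTian2014.thm11_ringClassChar ∧
    mazur_not_dvd_maninConstant_of_odd ∧
    Hsieh2014.thmB_exists_isHsiehLFunction_coeff_norm_eq_one_unrPeriod_ramifiedSteinberg ∧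
    LiuZhangZhang2018.thm151_thm153_modularCurve_heegnerVector_additive_ramifiedSteinberg ∧
    Literature.NumberTheory.EllipticCurves.HoffsteinLuo1997_exists_twist_L_one_ne_zero ∧
    Literature.NumberTheory.EllipticCurves.ModularForms.eichlerShimuraRelation_heckeNeighbour

/-! ### Registered stubs (the ONLY sorried declarations) -/

/-- stub (residualM) — (M) rows of analytic rank `≤ 1` OUTSIDE the sub-row (`p = 3`; `ρ̄` not onto, in
particular the X3(M) rows; a second additive prime; no Wan prime; rank `0` with `p ∣ v_ℓ(Δ)` at a split
multiplicative `ℓ`): the route's children (19590 `MultLambdaLower`, 19591, …) remain the plan there.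
The residual piece; not this line's content. [XL, open-problem, research by design; NOT benchable] -/
theorem stub_residualM :
    ∀ (W : WeierstrassCurve ℚ) [W.IsElliptic] [W.IsGloballyMinimal] (p : ℕ) [Fact p.Prime],
      W.analyticRank ≤ 1 → N10.CellM W p → ¬ RoadRowM W p → MissingLowerBoundAt W p := by
  sorry

/-- stub (printedFactsM) — cite-only (see `PrintedFactsM`). [CITE-ONLY — never a proof target, never benched] -/
theorem stub_printedFactsM : PrintedFactsM := by
  sorry

/-- stub (tameAwayFromCycM) — THE NAMED RESEARCH RESIDUAL (director-bsd g18 (368)(1)): on the tame (M) sub-row, at a tame-road field `K`,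
the two-variable divisibility away from the cyclotomic variable with its anticyclotomic restriction (`TameAwayFromCycAt W p K`) for
`E = V ⊗ χ_{p*}` with `V` MULTIPLICATIVE at `p`. No refereed source (CLW 2022 print Thm. 8.2.1 needs `π_p` unramified; Wan 2020 Thm 1.2 excludes
the tame class); candidates for a future typer: a CLW-type result for `π_p` Steinberg, or Wan's `𝕀`-adic Thm 1.1 in Hida-family currency.
[XL, research; NOT benchable] -/
theorem stub_tameAwayFromCycM : PrintedFactsM →
    ∀ (W : WeierstrassCurve ℚ) [W.IsElliptic] [W.IsGloballyMinimal] (p : ℕ) [Fact p.Prime]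
      (K : Type) [Field K] [NumberField K],
      W.analyticRank ≤ 1 → N10.CellM W p → TameRoadRow W p → TameRoadField W p K →
        TameAwayFromCycAt W p K := by
  sorry

/-! ### The road sub-row, closed modulo print and the research statement (in-file `_closed` theorem, sorry-free) -/

/-- **THE (M) ROAD SUB-ROW, CLOSED MODULO PRINT AND THE RESEARCH STATEMENT** (director-bsd g18 (390)(ii)): from the cite conjunction
`PrintedFactsM` and the two-variable divisibility `TameAwayFromCycAt` on the tame (M) sub-row, for every `E/ℚ` of analytic rank `≤ 1` and every
prime `p` of cell (M) on the road sub-row, `ord_p #Ш(E)_an ≤ ord_p #Ш(E)`. ONE application of the Theorems-side kernel object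
`TameRoadsMultClosedKolyvagin.missingLowerBoundAt_of_roadRowM_twelveFacts_kolyvagin` (LEAD g12; = p725639's composition with «GZK» derived from
Kolyvagin 1990 Thm. A + modularity + Hoffstein–Luo + BFH + Cai–Shu–Tian ring class, Nekovář's congruence derived from the Eichler–Shimura
relation, FIELD 1 supplied from Hoffstein–Luo / Bump–Friedberg–Hoffstein + modularity through the ramified-twist root-number engine, and with the
entire continuation, parity, Birch CM rationality, Gross 1991 Prop. 5.3 (pinned, Birch), Cai–Shu–Tian Thm 1.1 (trivial character) and
Gross–Zagier I.(7.3) over `ℚ` supplied by the tree). -/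
theorem roadRowM_closed (hPF : PrintedFactsM)
    (hAFC : ∀ (W : WeierstrassCurve ℚ) [W.IsElliptic] [W.IsGloballyMinimal] (p : ℕ) [Fact p.Prime]
      (K : Type) [Field K] [NumberField K],
      W.analyticRank ≤ 1 → N10.CellM W p → TameRoadRow W p → TameRoadField W p K → TameAwayFromCycAt W p K) :
    ∀ (W : WeierstrassCurve ℚ) [W.IsElliptic] [W.IsGloballyMinimal] (p : ℕ) [Fact p.Prime],
      W.analyticRank ≤ 1 → N10.CellM W p → RoadRowM W p → MissingLowerBoundAt W p :=
  fun W _ _ p _ hr hcell hrow => by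
    obtain ⟨f1, fK, f4, f5, fB, f11, f13, f15, f16, f17, f19, fES⟩ := hPF
    exact TameRoadsMultClosedKolyvagin.missingLowerBoundAt_of_roadRowM_twelveFacts_kolyvagin f1 fK f4 f5 fB f11 f13 f15 f16 f17 f19 fES
      (fun W _ _ p _ K _ _ hr hcell hrow hK => hAFC W p K hr hcell hrow hK) W p hr hcell hrow.1 hrow.2

/-! ### The composition (kernel-checked, no sorry of its own) -/

/-- THE SKELETON: the crux `MultLower` BY NAME from exactly the three registered stubs — by cases on «the pair lies on the road sub-row
`RoadRowM`»: on it `roadRowM_closed stub_printedFactsM (stub_tameAwayFromCycM stub_printedFactsM)`, off it `stub_residualM`. -/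
theorem MultLower_of : MultLower := by
  intro W _ _ p _ hr hcell
  by_cases hs : RoadRowM W p
  · exact roadRowM_closed stub_printedFactsM (stub_tameAwayFromCycM stub_printedFactsM) W p hr hcell hs
  · exact stub_residualM W p hr hcell hs

end Summit.BirchSwinnertonDyer.BirchSwinnertonDyer.Cruxes.MultLower.TameRoadsMult
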